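import Literature.NumberTheory.Sieve.BourgainSarnakZieglerCriterionProofs
import HarnessLib

/-!
# `QuadraticDigitPhases` (stmt-QuantumAdvantage-1391) — line `Sketch`, stub `stub_bszFixedN`:
# the Bourgain–Sarnak–Ziegler criterion at a fixed length

Crux `Summit.QuantumAdvantage.QuantumAdvantage.Theses.MobiusLadder.QuadraticDigitPhases`, line
`Sketch`. J. Bourgain, P. Sarnak, T. Ziegler, *Disjointness of Moebius from horocycle flows*,
Dev. Math. 28 (2013), Theorem 2 (the finite Kátai–Daboussi criterion), in the form needed by the
line: AT A FIXED LENGTH `N`, with a threshold `N₀(τ)` that does not depend on the phase `F` or on the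
multiplicative function `ν`, and with the pair hypothesis (1.3) required only at the lengths
`M = ⌊N / max(p₁, p₂)⌋` and only for the primes `1/τ < p₁ ≠ p₂ ≤ e^{1/τ}` the proof actually uses.
The tree's printed form `Literature.NumberTheory.Sieve.bourgainSarnakZiegler_criterion`
(`∀ᶠ M` hypothesis, `∀ᶠ N` conclusion) cannot be applied to phases that themselves depend on `N`;
but its PROOF (`Literature/NumberTheory/Sieve/BourgainSarnakZieglerCriterionProofs.lean`) is
`F`-independent up to the point where (1.3) enters, and we re-run it:

* `norm_sum_le_from` — the block estimate `BourgainSarnakZiegler.norm_sum_le_of_goodN` with its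
  `F`-independent slack absorbed from an EXPLICIT threshold
  `N₀ = max ⌈4bc/δ²⌉ ⌈2Q e^{-L}/δ⌉` (`b = HJ`, `c = L(1/H + τ)`, `Q = ∏ qᵢ`), replacing the two
  `eventually_ge_atTop` facts of `BourgainSarnakZiegler.eventually_norm_sum_le`;
* `exists_params` — the parameter package of `BourgainSarnakZiegler.criterion_of_le` (primes of
  `(k¹⁰, e^{1/τ}]`, `k = ⌈1/τ⌉`, blocks of `k²`, two-sided Mertens bookkeeping, `endgame`), with the
  extra (trivial) record that every prime used lies in `(1/τ, e^{1/τ}]`;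
* `stub_bszFixedN` — the registered stub, `τ₀ = e^{-64}`.
-/

set_option linter.dupNamespace false -- D-0017: single-problem summit ⇒ `QuantumAdvantage.QuantumAdvantage` by design

namespace Summit.QuantumAdvantage.QuantumAdvantage.Theorems.MobiusLadderQuadraticDigitPhasesStubBszFixedN

open Finset Filter
open Literature.NumberTheory.Sieve

/-- **The block estimate with an explicit threshold.** For a strictly increasing enumeration `q` of
primes `≥ D > 0`, cut into `J` blocks of `H` consecutive indices, `L = ∑_{i<JH} 1/qᵢ`, and any
`δ > 0`, there is `N₀` (depending only on these data) such that for all `N ≥ N₀`, all `1`-bounded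
`F` and multiplicative `1`-bounded `ν` satisfying the pair bound (1.3) at every
`M = ⌊N / max(qᵢ, qᵢ')⌋`, `i ≠ i' < JH`:
`‖∑_{n ≤ N} ν(n) F(n)‖ ≤ (√((1 + H/D) L (1/H + τ)) + e^{-L} + (H/D) L + δ) N`.
(`BourgainSarnakZiegler.eventually_norm_sum_le` with the filter facts made explicit.) [folklore] -/
theorem norm_sum_le_from {q : ℕ → ℕ} {H J : ℕ} (hq : StrictMono q) (hH : 0 < H) {τ : ℝ}
    (hτ : 0 ≤ τ) (hp : ∀ i < J * H, (q i).Prime) {D : ℝ} (hD : 0 < D) (hD0 : D ≤ q 0) {δ : ℝ}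
    (hδ : 0 < δ) :
    ∃ N₀ : ℕ, ∀ N : ℕ, N₀ ≤ N → ∀ (F : ℕ → ℂ) (ν : ArithmeticFunction ℂ),
      (∀ m, ‖F m‖ ≤ 1) → ν.IsMultiplicative → (∀ m, ‖ν m‖ ≤ 1) →
      (∀ i ∈ range (J * H), ∀ i' ∈ range (J * H), i ≠ i' →
        ‖∑ y ∈ Icc 1 (N / max (q i) (q i')), F (q i * y) * starRingEnd ℂ (F (q i' * y))‖ ≤
          τ * ((N / max (q i) (q i') : ℕ) : ℝ)) →
      ‖∑ m ∈ Icc 1 N, ν m * F m‖ ≤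
        (Real.sqrt ((1 + (H : ℝ) / D) * (∑ i ∈ range (J * H), (1 : ℝ) / q i) * (1 / (H : ℝ) + τ)) +
          Real.exp (-∑ i ∈ range (J * H), (1 : ℝ) / q i) +
          (H : ℝ) / D * (∑ i ∈ range (J * H), (1 : ℝ) / q i) + δ) * N := by
  set L := ∑ i ∈ range (J * H), (1 : ℝ) / q i with hLdef
  set Q := ∏ i ∈ range (J * H), (q i : ℝ) with hQdef
  have hL0 : 0 ≤ L := Finset.sum_nonneg fun i _ => by positivity
  have hHr : (0 : ℝ) < H := by exact_mod_cast hH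
  set c := L * (1 / H + τ) with hcdef
  have hc0 : 0 ≤ c := by positivity
  set b := (H : ℝ) * J with hbdef
  have hb0 : 0 ≤ b := by positivity
  refine ⟨max ⌈4 * b * c / δ ^ 2⌉₊ ⌈2 * Q * Real.exp (-L) / δ⌉₊, fun N hN F ν hF hν hν1 hE => ?_⟩
  have hN1 : 4 * b * c / δ ^ 2 ≤ N :=
    (Nat.le_ceil _).trans (by exact_mod_cast (le_max_left _ _).trans hN)
  have hN2 : 2 * Q * Real.exp (-L) / δ ≤ N :=
    (Nat.le_ceil _).trans (by exact_mod_cast (le_max_right _ _).trans hN)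
  have hN0 : (0 : ℝ) ≤ N := Nat.cast_nonneg N
  have main := BourgainSarnakZiegler.norm_sum_le_of_goodN hF hν hν1 hq hH hτ hp hD hD0 hE
  rw [show Icc 1 N = Ioc 0 N by
    ext m; simp only [mem_Icc, mem_Ioc]; omega]
  refine main.trans ?_
  rw [← hLdef, ← hQdef]
  -- the square-root term
  have hsq : Real.sqrt (N + H * N / D + H * J) * Real.sqrt (N * L * (1 / H + τ)) ≤
      Real.sqrt ((1 + H / D) * L * (1 / H + τ)) * N + δ / 2 * N := by
    have e1 : (N : ℝ) + H * N / D + H * J = (1 + H / D) * N + b := by rw [hbdef]; ring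
    have e2 : (N : ℝ) * L * (1 / H + τ) = N * c := by rw [hcdef]; ring
    rw [e1, e2]
    have hs : Real.sqrt ((1 + H / D) * N + b) ≤ Real.sqrt ((1 + H / D) * N) + Real.sqrt b := by
      have hx : (0 : ℝ) ≤ (1 + H / D) * N := by positivity
      rw [Real.sqrt_le_left (by positivity)]
      nlinarith [Real.sq_sqrt hx, Real.sq_sqrt hb0, Real.sqrt_nonneg ((1 + H / D) * N),
        Real.sqrt_nonneg b]
    calc Real.sqrt ((1 + H / D) * N + b) * Real.sqrt (N * c)
        ≤ (Real.sqrt ((1 + H / D) * N) + Real.sqrt b) * Real.sqrt (N * c) :=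
          mul_le_mul_of_nonneg_right hs (Real.sqrt_nonneg _)
      _ = Real.sqrt ((1 + H / D) * N) * Real.sqrt (N * c) + Real.sqrt b * Real.sqrt (N * c) := by
          ring
      _ ≤ Real.sqrt ((1 + H / D) * L * (1 / H + τ)) * N + δ / 2 * N := by
          apply add_le_add
          · rw [← Real.sqrt_mul (by positivity),
              show (1 + (H : ℝ) / D) * N * (N * c) = ((1 + H / D) * L * (1 / H + τ)) * (N * N) by
                rw [hcdef]; ring,
              Real.sqrt_mul (by positivity), Real.sqrt_mul_self hN0]
          · rw [← Real.sqrt_mul hb0, Real.sqrt_le_left (by positivity)]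
            have : b * c ≤ δ ^ 2 / 4 * N := by
              have := hN1
              rw [div_le_iff₀ (by positivity)] at this
              linarith
            nlinarith
  -- the sifted term
  have hsf : ((N : ℝ) + Q) * Real.exp (-L) ≤ Real.exp (-L) * N + δ / 2 * N := by
    have : Q * Real.exp (-L) ≤ δ / 2 * N := by
      have := hN2
      rw [div_le_iff₀ hδ] at this
      linarith
    nlinarith [Real.exp_pos (-L)]
  nlinarith [hsq, hsf]

/-- **The parameters of Bourgain–Sarnak–Ziegler §2 for `0 < τ ≤ e^{-64}`** (as in
`BourgainSarnakZiegler.criterion_of_le`): with `u = 1/τ`, `k = ⌈u⌉`, there are a strictly increasing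
`q` (the primes of `(k¹⁰, ⌊e^u⌋]` in increasing order, extended past the end), `H = k²`,
`J = #primes / H` and `D = k¹⁰ ≤ q₀` such that every `qᵢ`, `i < JH`, is a prime in `(1/τ, e^{1/τ}]`,
and the block-estimate constant satisfies
`√((1 + H/D) L (1/H + τ)) + e^{-L} + (H/D) L < 2 √(τ log(1/τ))`, `L = ∑_{i<JH} 1/qᵢ`
(two-sided Mertens bookkeeping and `BourgainSarnakZiegler.endgame`). [folklore] -/
theorem exists_params {τ : ℝ} (hτ0 : 0 < τ) (hτ1 : τ ≤ Real.exp (-64)) :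
    ∃ (q : ℕ → ℕ) (H J : ℕ) (D : ℝ), StrictMono q ∧ 0 < H ∧ (∀ i < J * H, (q i).Prime) ∧
      0 < D ∧ D ≤ q 0 ∧ (∀ i < J * H, 1 / τ < (q i : ℝ) ∧ (q i : ℝ) ≤ Real.exp (1 / τ)) ∧
      Real.sqrt ((1 + (H : ℝ) / D) * (∑ i ∈ range (J * H), (1 : ℝ) / q i) * (1 / (H : ℝ) + τ)) +
          Real.exp (-∑ i ∈ range (J * H), (1 : ℝ) / q i) +
          (H : ℝ) / D * (∑ i ∈ range (J * H), (1 : ℝ) / q i) <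
        2 * Real.sqrt (τ * Real.log (1 / τ)) := by
  -- the parameters (verbatim from `BourgainSarnakZiegler.criterion_of_le`)
  set u : ℝ := 1 / τ with hudef
  have hu64 : Real.exp 64 ≤ u := by
    have : 1 / Real.exp (-64) ≤ 1 / τ := one_div_le_one_div_of_le hτ0 hτ1
    rwa [Real.exp_neg, one_div, inv_inv] at this
  have he : (810000 : ℝ) ≤ Real.exp 64 := by
    have h1 : (2 : ℝ) ≤ Real.exp 1 := by
      have := Real.add_one_le_exp (1 : ℝ); norm_num at this ⊢; linarith
    calc (810000 : ℝ) ≤ (2 : ℝ) ^ 64 := by norm_num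
      _ ≤ (Real.exp 1) ^ 64 := pow_le_pow_left₀ (by norm_num) h1 64
      _ = Real.exp 64 := by rw [Real.exp_one_pow]; norm_num
  have hu : 810000 ≤ u := he.trans hu64
  have hu0 : 0 < u := by linarith
  have hℓ : 64 ≤ Real.log u := by
    have := Real.log_le_log (Real.exp_pos 64) hu64
    rwa [Real.log_exp] at this
  have hτu : τ = 1 / u := by rw [hudef, one_div_one_div]
  set k : ℕ := ⌈u⌉₊ with hkdef
  have hk : u ≤ k := Nat.le_ceil u
  have hk1 : (k : ℝ) ≤ u + 1 := (Nat.ceil_lt_add_one hu0.le).le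
  have hk2 : 2 ≤ k := by
    have : (2 : ℝ) ≤ k := by linarith
    exact_mod_cast this
  have hkpos : 0 < k := by omega
  set H : ℕ := k ^ 2 with hHdef
  have hH : 0 < H := pow_pos hkpos 2
  set D₀ : ℕ := k ^ 10 with hD₀def
  set X : ℕ := ⌊Real.exp u⌋₊ with hXdef
  have hXle : (X : ℝ) ≤ Real.exp u := Nat.floor_le (Real.exp_pos u).le
  have hX2 : 2 ≤ X := by
    apply Nat.le_floor
    push_cast
    linarith [Real.add_one_le_exp u]
  have hD₀r : ((D₀ : ℕ) : ℝ) = (k : ℝ) ^ 10 := by rw [hD₀def]; push_cast; ring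
  have hDX' : ((D₀ : ℕ) : ℝ) ≤ Real.exp u := by
    rw [hD₀r]
    calc (k : ℝ) ^ 10 ≤ (2 * u) ^ 10 := pow_le_pow_left₀ (by positivity) (by linarith) 10
      _ ≤ Real.exp u := BourgainSarnakZiegler.pow_le_exp hu
  have hDX : D₀ ≤ X := Nat.le_floor hDX'
  set P₀ : Finset ℕ := (Finset.Ioc D₀ X).filter Nat.Prime with hP₀def
  have hPmem : ∀ p ∈ P₀, p.Prime ∧ D₀ < p ∧ p ≤ X := fun p hp => by
    simp only [hP₀def, Finset.mem_filter, Finset.mem_Ioc] at hp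
    exact ⟨hp.2, hp.1.1, hp.1.2⟩
  have hPX : ∀ p ∈ P₀, p ≤ X := fun p hp => (hPmem p hp).2.2
  set n₀ := P₀.card with hn₀def
  -- the increasing enumeration of `P₀`, extended past the end by `X + 1 + i`
  have hcard : P₀.card = n₀ := hn₀def.symm
  set q : ℕ → ℕ := fun i => if h : i < n₀ then (P₀.orderEmbOfFin hcard ⟨i, h⟩ : ℕ)
    else X + 1 + i with hqdef
  have hq : StrictMono q := by
    intro a b hab
    simp only [hqdef]
    by_cases ha : a < n₀ <;> by_cases hb : b < n₀
    · simp only [dif_pos ha, dif_pos hb]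
      exact (P₀.orderEmbOfFin hcard).strictMono (Fin.mk_lt_mk.mpr hab)
    · simp only [dif_pos ha, dif_neg hb]
      have := hPX _ (Finset.orderEmbOfFin_mem P₀ hcard ⟨a, ha⟩)
      omega
    · omega
    · simp only [dif_neg ha, dif_neg hb]; omega
  have hqmem : ∀ i < n₀, q i ∈ P₀ := fun i hi => by
    simp only [hqdef, dif_pos hi]
    exact Finset.orderEmbOfFin_mem P₀ hcard _
  have hPq : P₀ ⊆ (Finset.range n₀).image q := by
    intro p hp
    have : p ∈ Set.range (P₀.orderEmbOfFin hcard) := by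
      rw [Finset.range_orderEmbOfFin]; exact hp
    obtain ⟨⟨i, hi⟩, rfl⟩ := this
    exact Finset.mem_image.2 ⟨i, Finset.mem_range.2 hi, by simp only [hqdef, dif_pos hi]⟩
  set J := n₀ / H with hJdef
  have hJH : J * H ≤ n₀ := Nat.div_mul_le_self n₀ H
  have hp : ∀ i < J * H, (q i).Prime := fun i hi => (hPmem _ (hqmem i (lt_of_lt_of_le hi hJH))).1
  have hD₀q : D₀ ≤ q 0 := by
    by_cases h0 : 0 < n₀
    · exact ((hPmem _ (hqmem 0 h0)).2.1).le
    · simp only [hqdef, dif_neg h0]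
      omega
  set D : ℝ := (k : ℝ) ^ 10 with hDdef
  have hDpos : 0 < D := by positivity
  have hDq : D ≤ q 0 := by
    have : ((D₀ : ℕ) : ℝ) ≤ q 0 := by exact_mod_cast hD₀q
    rwa [hD₀r] at this
  -- the chosen primes lie in `(1/τ, e^{1/τ}]` (the only new line w.r.t. `criterion_of_le`)
  have hrange : ∀ i < J * H, u < (q i : ℝ) ∧ (q i : ℝ) ≤ Real.exp u := by
    intro i hi
    have hmi := hPmem _ (hqmem i (lt_of_lt_of_le hi hJH))
    refine ⟨?_, le_trans (by exact_mod_cast hmi.2.2) hXle⟩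
    have hk10 : k ≤ D₀ := by
      rw [hD₀def]
      exact le_self_pow₀ (by omega) (by norm_num)
    have h1 : ((k : ℕ) : ℝ) ≤ ((D₀ : ℕ) : ℝ) := by exact_mod_cast hk10
    have h2 : ((D₀ : ℕ) : ℝ) < q i := by exact_mod_cast hmi.2.1
    linarith
  -- bounds for `L = ∑ 1/qᵢ`
  set L := ∑ i ∈ Finset.range (J * H), (1 : ℝ) / q i with hLdef
  have hL0 : 0 ≤ L := Finset.sum_nonneg fun _ _ => by positivity
  have hL1 : L ≤ Real.log u + 4 := by
    have h1 : L ≤ ∑ p ∈ Nat.primesLE X, (1 : ℝ) / p := by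
      rw [hLdef, ← Finset.sum_image (f := fun p : ℕ => (1 : ℝ) / (p : ℝ)) (g := q)
        (fun i _ i' _ h => hq.injective h)]
      apply Finset.sum_le_sum_of_subset_of_nonneg
      · intro p hp
        rw [Finset.mem_image] at hp
        obtain ⟨i, hi, rfl⟩ := hp
        have hm := hPmem _ (hqmem i (lt_of_lt_of_le (Finset.mem_range.1 hi) hJH))
        exact Nat.mem_primesLE.2 ⟨hm.2.2, hm.1⟩
      · intro p _ _
        positivity
    have h2 := Literature.NumberTheory.LFunctions.MertensBound.sum_inv_prime_le X hX2
    have h3 : Real.log (Real.log X) ≤ Real.log u := by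
      have hX0 : (0 : ℝ) < X := by exact_mod_cast lt_of_lt_of_le two_pos hX2
      have hlogX : Real.log X ≤ u := by
        have := Real.log_le_log hX0 hXle
        rwa [Real.log_exp] at this
      have hX1 : (1 : ℝ) < X := by exact_mod_cast lt_of_lt_of_le one_lt_two hX2
      exact Real.log_le_log (Real.log_pos hX1) hlogX
    linarith
  have hL2 : Real.log u - Real.log (10 * Real.log k) - 6 / (10 * Real.log k) -
      (k : ℝ) ^ 2 / (k : ℝ) ^ 10 ≤ L := by
    have h2P : (2 : ℝ) ≤ ((D₀ : ℕ) : ℝ) := by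
      rw [hD₀r]
      have : (2 : ℝ) ^ 10 ≤ (k : ℝ) ^ 10 :=
        pow_le_pow_left₀ (by norm_num) (by exact_mod_cast hk2) 10
      linarith [show (2 : ℝ) ^ 10 = 1024 by norm_num]
    have hM := Literature.NumberTheory.LFunctions.MertensBound.loglog_sub_loglog_le_sum_inv_prime
      h2P hDX'
    rw [Nat.floor_natCast, Real.log_exp, hD₀r, Real.log_pow] at hM
    change Real.log u - Real.log ((10 : ℕ) * Real.log k) - 6 / ((10 : ℕ) * Real.log k) ≤
      ∑ p ∈ P₀, (1 : ℝ) / p at hM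
    push_cast at hM
    have hP : ∑ p ∈ P₀, (1 : ℝ) / p ≤ ∑ i ∈ Finset.range n₀, (1 : ℝ) / q i := by
      rw [← Finset.sum_image (f := fun p : ℕ => (1 : ℝ) / (p : ℝ)) (g := q)
        (fun i _ i' _ h => hq.injective h)]
      exact Finset.sum_le_sum_of_subset_of_nonneg hPq fun _ _ _ => by positivity
    have hsplit : ∑ i ∈ Finset.range n₀, (1 : ℝ) / q i =
        L + ∑ i ∈ Finset.Ico (J * H) n₀, (1 : ℝ) / q i := by
      rw [hLdef, Finset.sum_range_add_sum_Ico _ hJH]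
    have htail : ∑ i ∈ Finset.Ico (J * H) n₀, (1 : ℝ) / q i ≤ (k : ℝ) ^ 2 / (k : ℝ) ^ 10 := by
      have hlt : n₀ - J * H < H := by
        have e : H * J + n₀ % H = n₀ := Nat.div_add_mod n₀ H
        have e' : n₀ - J * H = n₀ % H := by
          apply Nat.sub_eq_of_eq_add
          rw [mul_comm]; omega
        rw [e']
        exact Nat.mod_lt n₀ hH
      calc ∑ i ∈ Finset.Ico (J * H) n₀, (1 : ℝ) / q i ≤ ∑ i ∈ Finset.Ico (J * H) n₀, 1 / D := by
            apply Finset.sum_le_sum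
            intro i hi
            have hin : i < n₀ := (Finset.mem_Ico.1 hi).2
            have hDi := (hPmem _ (hqmem i hin)).2.1
            apply one_div_le_one_div_of_le hDpos
            have : ((D₀ : ℕ) : ℝ) ≤ q i := by exact_mod_cast hDi.le
            rwa [hD₀r] at this
        _ = ((n₀ - J * H : ℕ) : ℝ) * (1 / D) := by
            rw [Finset.sum_const, Nat.card_Ico, nsmul_eq_mul]
        _ ≤ H * (1 / D) := by
            apply mul_le_mul_of_nonneg_right _ (by positivity)
            exact_mod_cast hlt.le
        _ = (k : ℝ) ^ 2 / (k : ℝ) ^ 10 := by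
            rw [hHdef, hDdef]; push_cast; ring
    linarith [hM, hP, hsplit, htail]
  -- the endgame
  have hB := BourgainSarnakZiegler.endgame hu hℓ hk hk1 hL0 hL1 hL2
  have hHr : (H : ℝ) = (k : ℝ) ^ 2 := by rw [hHdef]; push_cast; ring
  have hfin : Real.sqrt ((1 + (H : ℝ) / D) * L * (1 / (H : ℝ) + τ)) + Real.exp (-L) +
      (H : ℝ) / D * L < 2 * Real.sqrt (τ * Real.log u) := by
    rw [hHr, hDdef, hτu]
    exact hB
  refine ⟨q, H, J, D, hq, hH, hp, hDpos, hDq, hrange, ?_⟩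
  rw [← hLdef]
  exact hfin

/-- **Bourgain–Sarnak–Ziegler 2013, Theorem 2, at a fixed length.** There is `τ₀ > 0`
(`τ₀ = e^{-64}`) such that for every `0 < τ ≤ τ₀` there is a threshold `N₀ = N₀(τ)` — independent
of `F` and `ν` — with the following property for every `N ≥ N₀`: if `F : ℕ → ℂ` with `‖F‖ ≤ 1` and a
multiplicative `ν` with `‖ν‖ ≤ 1` satisfy the pair bound
`‖∑_{1 ≤ m ≤ N/max(p₁,p₂)} F(p₁ m) conj F(p₂ m)‖ ≤ τ ⌊N / max(p₁, p₂)⌋` for all primes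
`p₁ ≠ p₂` in `(1/τ, e^{1/τ}]`, then `‖∑_{1 ≤ m ≤ N} ν(m) F(m)‖ ≤ 2 √(τ log(1/τ)) N`.
This is the paper's §2 argument run at the single length `N` (the primes it uses are those of
`(⌈1/τ⌉¹⁰, e^{1/τ}]`), via the tree's `BourgainSarnakZiegler.norm_sum_le_of_goodN` and `endgame`.
[cite: BourgainSarnakZiegler2013, Theorem 2] -/
theorem stub_bszFixedN :
    ∃ τ₀ : ℝ, 0 < τ₀ ∧ ∀ τ : ℝ, 0 < τ → τ ≤ τ₀ → ∃ N₀ : ℕ, ∀ N : ℕ, N₀ ≤ N →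
      ∀ (F : ℕ → ℂ) (ν : ArithmeticFunction ℂ),
        (∀ m, ‖F m‖ ≤ 1) → ν.IsMultiplicative → (∀ m, ‖ν m‖ ≤ 1) →
        (∀ p₁ p₂ : ℕ, p₁.Prime → p₂.Prime → p₁ ≠ p₂ →
            1 / τ < (p₁ : ℝ) → (p₁ : ℝ) ≤ Real.exp (1 / τ) →
            1 / τ < (p₂ : ℝ) → (p₂ : ℝ) ≤ Real.exp (1 / τ) →
            ‖∑ m ∈ Icc 1 (N / max p₁ p₂), F (p₁ * m) * starRingEnd ℂ (F (p₂ * m))‖ ≤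
              τ * ((N / max p₁ p₂ : ℕ) : ℝ)) →
        ‖∑ m ∈ Icc 1 N, ν m * F m‖ ≤ 2 * Real.sqrt (τ * Real.log (1 / τ)) * N := by
  refine ⟨Real.exp (-64), Real.exp_pos _, fun τ hτ0 hτ1 => ?_⟩
  obtain ⟨q, H, J, D, hq, hH, hp, hD, hD0, hrange, hB⟩ := exists_params hτ0 hτ1
  obtain ⟨N₀, hN₀⟩ := norm_sum_le_from hq hH hτ0.le hp hD hD0 (sub_pos.2 hB)
  refine ⟨N₀, fun N hN F ν hF hν hν1 hyp => ?_⟩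
  have hE : ∀ i ∈ range (J * H), ∀ i' ∈ range (J * H), i ≠ i' →
      ‖∑ y ∈ Icc 1 (N / max (q i) (q i')), F (q i * y) * starRingEnd ℂ (F (q i' * y))‖ ≤
        τ * ((N / max (q i) (q i') : ℕ) : ℝ) := fun i hi i' hi' hne =>
    hyp (q i) (q i') (hp i (mem_range.1 hi)) (hp i' (mem_range.1 hi'))
      (fun h => hne (hq.injective h)) (hrange i (mem_range.1 hi)).1 (hrange i (mem_range.1 hi)).2
      (hrange i' (mem_range.1 hi')).1 (hrange i' (mem_range.1 hi')).2
  refine (hN₀ N hN F ν hF hν hν1 hE).trans_eq ?_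
  ring

end Summit.QuantumAdvantage.QuantumAdvantage.Theorems.MobiusLadderQuadraticDigitPhasesStubBszFixedN
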